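import Summits.ResolutionOfSingularities.ResolutionOfSingularities.Theorems.EquisingularLiftEquisingularLiftNatSecCurveCartier
import HarnessLib

/-!
# [OURS · L1 W4.5(b) · EL♮(3) · WIDTH TABLE D13 «(P-ram-Γ) / E-ROUND», supplier part 1] A RELATIVE CURVE CUT ON A (POSSIBLY NON-REDUCED) HOST TRACE BY ONE
# PARAMETER IS AN EFFECTIVE CARTIER DIVISOR OF THE TRACE — `EmbeddedLiftFact`'s lci clause in IDEAL-SHEAF currency

res-L1-w45b-stub-2 g20 (D13 supplier pen, desk R74b (d)).  This is ✓ p708682 `…NatSecCurveCartier` (res-L1-w45b-nose-w1 g6, W₂ brick (A) «(L2)-Cartier»)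
with the two REDUCED subschemes `Z̃ = redSub G Z ⊆ Ẽ = redSub G E` replaced by two ARBITRARY closed subschemes `V(𝓘) ⊆ V(𝓙)` of `G` (`𝓙 ≤ 𝓘` ideal
sheaves): the E-ROUND of lead-1's `E-ROUNDS.md` (3.1) blows up a relative plane curve inside the exceptional divisor `E_{L′} ≅ ℙ²_{O′}` of a RAM, whose
trace on the special fibre is the e-FOLD plane `V(𝓙)`, `𝓙 = J·𝒪_{F₂}` (NOT reduced: `ϖ ∈ 𝔪²` at a deep point forces `e ≥ 2`), and whose centre traces to
the CUSTOMER's ideal `𝓘 ⊇ 𝓙` (res-L1-w45b-idea-2, STATUS 2026-08-29T08:30:20Z).  Nothing in (A)'s proof used reducedness — only that `redSub` is a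
`.subscheme` — so the port is by substitution (`redSub G E hE ↦ 𝓙.subscheme`, `𝓘⟨E⟩ ↦ 𝓙`, `redSub G Z hZ ↦ 𝓘.subscheme`, `𝓘⟨Z⟩ ↦ 𝓘`); §1's ring lemmas
are IMPORTED from (A).

* ★ `ERound.ker_stalkMap_eq_span_and_isSMulRegular` — at a closed point `z` of `V(𝓘)`: with the host's REGULAR `O`-flat model `W` (model square
  `jW : V(𝓙) ⟶ W`), (Γ1) `dim 𝒪_{V(𝓘),z} = 1`, (Γ2) `dim 𝒪_{V(𝓙),i z} = 2` and the letter (PΓ) `𝓘_z = 𝓙_z + (f)`, `f ∉ 𝓙_z + 𝔪_z²`, the kernel of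
  `𝒪_{V(𝓙),i z} ↠ 𝒪_{V(𝓘),z}` is `(f̄)`, `f̄ ∈ 𝔪 ∖ 𝔪²`, and `f̄` is a NON-ZERO-DIVISOR (through the regular parameter `f̃` of the regular 3-dimensional
  `𝒪_{W, jW (i z)}`: `W/(f̃)` regular domain of dimension 2, `ϖ̃ ∉ (f̃)` by (Γ1), swap).
* ★★ `ERound.exists_affineOpens_isWeaklyRegular_ker` — `EmbeddedLiftFact`'s local-complete-intersection clause for `i : V(𝓘) ⟶ V(𝓙)` VERBATIM in shape.

DEF-FREE; no `sorry`; standard axioms; `--supports stmt-ResolutionOfSingularities-20148 --as helper`, counted 0.  EL♮(3) is NOT proved; resolution of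
singularities in positive characteristic is NOT proved anywhere in this tree; nothing of [Hironaka2017] is asserted.  AI-written, weaker than expert review.
References (method only): H. Matsumura, *Commutative Ring Theory* (1986), Thm. 14.2, §6.
-/

set_option linter.dupNamespace false -- mandated namespace `Summit.<Summit>.<Problem>` of this single-conjunct summit

noncomputable section

open CategoryTheory AlgebraicGeometry TopologicalSpace IsLocalRing
open Literature.AlgebraicGeometry.Resolution
open AlgebraicGeometry.Scheme.IdealSheafData
open Summit.ResolutionOfSingularities.ResolutionOfSingularities.Cruxes.EquisingularLift.StrataSplit

namespace Summit.ResolutionOfSingularities.ResolutionOfSingularities.Cruxes.EquisingularLiftNat.Sections.ERound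

open Summit.ResolutionOfSingularities.ResolutionOfSingularities.Cruxes.EquisingularLiftNat.Sections
open Summit.ResolutionOfSingularities.ResolutionOfSingularities.Cruxes.EquisingularLiftNat.Sections.SecCurve

universe u v

/-! ## §2 At a closed point: the ideal of `V(𝓘)` in `V(𝓙)` is generated by ONE parameter which is a non-zero-divisor -/

section Stalk

variable (O : Type) [CommRing O] [IsDomain O] [IsDiscreteValuationRing O] {k : Type} [Field k] (θ : O →+* k) (hθ : Function.Surjective θ)
  {G : Scheme.{0}} (𝓘 𝓙 : G.IdealSheafData)
  -- the host's regular model `W` over `O`, with special fibre `V(𝓙)` (model square `jW`)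
  {W : Scheme.{0}} (w : W ⟶ Spec (.of O)) (jW : 𝓙.subscheme ⟶ W) (tW : 𝓙.subscheme ⟶ Spec (.of k))
  (hsqW : IsPullback jW tW w (Spec.map (CommRingCat.ofHom θ)))

include hθ hsqW in
/-- ★ **At a point of `V(𝓘)` (used at CLOSED points): the kernel of `𝒪_{V(𝓙),i z} ↠ 𝒪_{V(𝓘),z}` for `i : V(𝓘) ⟶ V(𝓙)` (`i ≫ ι_𝓙 = ι_𝓘`) is `(f̄)`
with `f̄ ∈ 𝔪 ∖ 𝔪²` a NON-ZERO-DIVISOR of `𝒪_{V(𝓙),i z}`** — ✓ `SecCurve.ker_stalkMap_eq_span_and_isSMulRegular` for arbitrary (possibly non-reduced)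
closed subschemes.  Inputs: the host's regular `O`-flat model `W` (model square `jW`, `W` locally Noetherian), (Γ1) `dim 𝒪_{V(𝓘),z} = 1`,
(Γ2) `dim 𝒪_{V(𝓙),i z} = 2`, and (PΓ) at the image point of `G`. [folklore; Matsumura 14.2 + the swap] [OURS · D13 supplier part 1; counted 0] -/
theorem ker_stalkMap_eq_span_and_isSMulRegular [IsLocallyNoetherian W] [Flat w] (hWreg : Scheme.IsRegular W)
    (i : 𝓘.subscheme ⟶ 𝓙.subscheme) (hi : i ≫ 𝓙.subschemeι = 𝓘.subschemeι) (z : ↥(𝓘.subscheme))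
    (hZdim : ringKrullDim ((𝓘.subscheme).presheaf.stalk z) = ((1 : ℕ) : WithBot ℕ∞))
    (hEdim : ringKrullDim ((𝓙.subscheme).presheaf.stalk (i z)) = ((2 : ℕ) : WithBot ℕ∞))
    (hL2 : ∃ f : G.presheaf.stalk ((𝓘.subschemeι) z),
      stalkIdeal (𝓘) ((𝓘.subschemeι) z) =
          stalkIdeal (𝓙) ((𝓘.subschemeι) z) ⊔ Ideal.span {f} ∧
        f ∉ stalkIdeal (𝓙) ((𝓘.subschemeι) z) ⊔ maximalIdeal (G.presheaf.stalk ((𝓘.subschemeι) z)) ^ 2) :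
    ∃ fb : (𝓙.subscheme).presheaf.stalk (i z),
      RingHom.ker (i.stalkMap z).hom = Ideal.span {fb} ∧
      fb ∈ maximalIdeal ((𝓙.subscheme).presheaf.stalk (i z)) ∧
      fb ∉ maximalIdeal ((𝓙.subscheme).presheaf.stalk (i z)) ^ 2 ∧
      IsSMulRegular ((𝓙.subscheme).presheaf.stalk (i z)) fb := by
  set ι : 𝓘.subscheme ⟶ 𝓙.subscheme := i with hι
  have hιfac : ι ≫ 𝓙.subschemeι = 𝓘.subschemeι := hi
  -- the point downstairs and the two stalk maps `πE : 𝒪_{G,z₀} ↠ 𝒪_{Ẽ,ι z}`, `πι : 𝒪_{Ẽ,ι z} ↠ 𝒪_{Z̃,z}`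
  set y := ι z with hy
  have hz₀ : (𝓙.subschemeι) y = (𝓘.subschemeι) z := by
    rw [hy, ← Scheme.Hom.comp_apply, hιfac]
  set B := (𝓙.subscheme).presheaf.stalk y with hB
  set πE : G.presheaf.stalk ((𝓙.subschemeι) y) →+* B := ((𝓙.subschemeι).stalkMap y).hom with hπE
  have hπEsurj : Function.Surjective πE := (𝓙.subschemeι).stalkMap_surjective y
  have hkerE : RingHom.ker πE = stalkIdeal (𝓙) ((𝓙.subschemeι) y) := by
    rw [hπE, ← stalkIdeal_ker_eq_ker_stalkMap, ker_subschemeι]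
  set πι : B →+* (𝓘.subscheme).presheaf.stalk z := (ι.stalkMap z).hom with hπι
  haveI : IsClosedImmersion (ι ≫ 𝓙.subschemeι) := by rw [hιfac]; infer_instance
  haveI : IsClosedImmersion ι := IsClosedImmersion.of_comp_isClosedImmersion ι (𝓙.subschemeι)
  have hπιsurj : Function.Surjective πι := ι.stalkMap_surjective z
  -- `ker (πι ∘ πE) = 𝓘⟨Z⟩_{z₀}`
  have hcomp : πι.comp πE = ((ι ≫ 𝓙.subschemeι).stalkMap z).hom := by
    rw [hπι, hπE, Scheme.Hom.stalkMap_comp]; rfl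
  have hkerZ : RingHom.ker (πι.comp πE) = stalkIdeal (𝓘) ((𝓙.subschemeι) y) := by
    have h1 : stalkIdeal (ι ≫ 𝓙.subschemeι).ker ((ι ≫ 𝓙.subschemeι) z) = RingHom.ker (((ι ≫ 𝓙.subschemeι).stalkMap z).hom) :=
      stalkIdeal_ker_eq_ker_stalkMap _ z
    have hk : (ι ≫ 𝓙.subschemeι).ker = 𝓘 := by rw [hιfac, ker_subschemeι]
    rw [hk] at h1
    rw [hcomp]
    exact h1.symm
  -- read (L2) at `z₀ = ι_E y`
  rw [← hz₀] at hL2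
  obtain ⟨f, hf, hf2⟩ := hL2
  refine ⟨πE f, ?_, ?_, ?_, ?_⟩
  · -- (a) the generator
    rw [ker_eq_map_ker_comp_of_surjective πE hπEsurj πι, hkerZ, hf, Ideal.map_sup, ← hkerE, Ideal.map_span, Set.image_singleton]
    rw [(Ideal.map_eq_bot_iff_le_ker πE).mpr le_rfl, bot_sup_eq]
  · -- `f̄ ∈ 𝔪`: `𝓘⟨Z⟩_{z₀} ≤ 𝔪`
    have hzZ : (𝓙.subschemeι) y ∈ (((𝓘) : G.IdealSheafData).support : Set G) := by
      rw [hz₀, ← Scheme.IdealSheafData.range_subschemeι]; exact ⟨z, rfl⟩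
    have hfm : f ∈ maximalIdeal (G.presheaf.stalk ((𝓙.subschemeι) y)) :=
      (mem_support_iff_stalkIdeal_le _ _).mp hzZ (hf ▸ Ideal.mem_sup_right (Ideal.mem_span_singleton_self f))
    rw [← IsLocalRing.map_maximalIdeal_of_surjective πE hπEsurj]
    exact Ideal.mem_map_of_mem _ hfm
  · -- (b) `f̄ ∉ 𝔪²`
    intro h2
    apply hf2
    rw [← IsLocalRing.map_maximalIdeal_of_surjective πE hπEsurj, ← Ideal.map_pow] at h2
    have h3 := Ideal.mem_comap.mpr h2
    rw [Ideal.comap_map_of_surjective πE hπEsurj, ← RingHom.ker_eq_comap_bot, hkerE, sup_comm] at h3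
    exact h3
  · -- (c) NON-ZERO-DIVISOR, through the regular model `W`
    haveI : IsClosedImmersion (Spec.map (CommRingCat.ofHom θ)) := IsClosedImmersion.spec_of_surjective _ hθ
    set A := W.presheaf.stalk (jW y) with hA
    haveI : IsRegularLocalRing A := hWreg _
    obtain ⟨ϖ, hϖ⟩ := IsDiscreteValuationRing.exists_irreducible O
    set ϖb : A := (W.presheaf.Γgerm (jW y)).hom (w.appTop.hom ((Scheme.ΓSpecIso (.of O)).inv.hom ϖ)) with hϖb
    set πW : A →+* B := (jW.stalkMap y).hom with hπW
    have hπWsurj : Function.Surjective πW := stalkMap_model_surjective θ hθ w jW tW hsqW y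
    have hkerW : RingHom.ker πW = Ideal.span {ϖb} := ModelSquare.ker_stalkMap_eq_span_germ O θ hθ w jW tW hsqW y ϖ hϖ
    have hdimA : ringKrullDim A = ringKrullDim B + 1 := ModelSquare.ringKrullDim_stalk_eq_fibre_add_one O θ hθ w jW tW hsqW y
    -- a lift `f̃` of `f̄`, a regular parameter of `A`
    obtain ⟨ft, hft⟩ := hπWsurj (πE f)
    have hmapW : (maximalIdeal A).map πW = maximalIdeal B := IsLocalRing.map_maximalIdeal_of_surjective πW hπWsurj
    have hfbm : πE f ∈ maximalIdeal B := by
      have hzZ : (𝓙.subschemeι) y ∈ (((𝓘) : G.IdealSheafData).support : Set G) := by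
        rw [hz₀, ← Scheme.IdealSheafData.range_subschemeι]; exact ⟨z, rfl⟩
      have hfm : f ∈ maximalIdeal (G.presheaf.stalk ((𝓙.subschemeι) y)) :=
        (mem_support_iff_stalkIdeal_le _ _).mp hzZ (hf ▸ Ideal.mem_sup_right (Ideal.mem_span_singleton_self f))
      rw [← IsLocalRing.map_maximalIdeal_of_surjective πE hπEsurj]
      exact Ideal.mem_map_of_mem _ hfm
    have hfb2 : πE f ∉ maximalIdeal B ^ 2 := by
      intro h2
      apply hf2
      rw [← IsLocalRing.map_maximalIdeal_of_surjective πE hπEsurj, ← Ideal.map_pow] at h2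
      have h3 := Ideal.mem_comap.mpr h2
      rw [Ideal.comap_map_of_surjective πE hπEsurj, ← RingHom.ker_eq_comap_bot, hkerE, sup_comm] at h3
      exact h3
    have hftm : ft ∈ maximalIdeal A := by
      have : πW ft ∈ maximalIdeal B := hft ▸ hfbm
      have h := Ideal.mem_comap.mpr this
      rwa [← hmapW, Ideal.comap_map_of_surjective πW hπWsurj, ← RingHom.ker_eq_comap_bot, hkerW,
        sup_eq_left.mpr ((Ideal.span_singleton_le_iff_mem _).mpr (ModelSquare.germ_mem_maximalIdeal O θ hθ w jW tW hsqW y ϖ hϖ))] at h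
    have hft2 : ft ∉ maximalIdeal A ^ 2 := by
      intro h
      apply hfb2
      rw [← hft, ← hmapW, ← Ideal.map_pow]
      exact Ideal.mem_map_of_mem _ h
    obtain ⟨hregq, hdimq⟩ := IsRegularLocalRing.quotient_span_singleton hftm hft2
    haveI := hregq
    haveI : IsDomain (A ⧸ Ideal.span {ft}) := isDomain_of_isRegularLocalRing _
    -- `ϖ̃ ∉ (f̃)`: otherwise `𝒪_{Z̃,z} ≅ B ⧸ (f̄) ≅ A ⧸ (f̃)` has dimension `2`, not `1`
    have hϖft : ϖb ∉ Ideal.span {ft} := by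
      intro hmem
      -- `A ⧸ (f̃) ≃ B ⧸ (f̄)` since `ker πW = (ϖ̃) ≤ (f̃)`
      have hker1 : RingHom.ker ((Ideal.Quotient.mk (Ideal.span {πE f})).comp πW) = Ideal.span {ft} := by
        rw [← RingHom.comap_ker, Ideal.mk_ker, ← hft, ← Set.image_singleton (f := πW), ← Ideal.map_span,
          Ideal.comap_map_of_surjective πW hπWsurj, ← RingHom.ker_eq_comap_bot, hkerW]
        exact sup_eq_left.mpr ((Ideal.span_singleton_le_iff_mem _).mpr hmem)
      have e1 : A ⧸ Ideal.span {ft} ≃+* B ⧸ Ideal.span {πE f} :=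
        (Ideal.quotEquivOfEq hker1.symm).trans (RingHom.quotientKerEquivOfSurjective
          (Ideal.Quotient.mk_surjective.comp hπWsurj))
      -- `B ⧸ (f̄) ≃ 𝒪_{Z̃,z}`
      have hkerι : RingHom.ker πι = Ideal.span {πE f} := by
        rw [ker_eq_map_ker_comp_of_surjective πE hπEsurj πι, hkerZ, hf, Ideal.map_sup, ← hkerE, Ideal.map_span, Set.image_singleton,
          (Ideal.map_eq_bot_iff_le_ker πE).mpr le_rfl, bot_sup_eq]
      have e2 : B ⧸ Ideal.span {πE f} ≃+* (𝓘.subscheme).presheaf.stalk z :=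
        (Ideal.quotEquivOfEq hkerι.symm).trans (RingHom.quotientKerEquivOfSurjective hπιsurj)
      have hd : ringKrullDim (A ⧸ Ideal.span {ft}) = ((1 : ℕ) : WithBot ℕ∞) := by
        rw [ringKrullDim_eq_of_ringEquiv (e1.trans e2)]; exact hZdim
      rw [hd, hdimA, hEdim] at hdimq
      exact absurd hdimq (by decide)
    -- the swap: `f̄` is a non-zero-divisor of `B = A ⧸ (ϖ̃)`
    have hϖreg : ∀ b : A, ϖb * b ∈ Ideal.span {ft} → b ∈ Ideal.span {ft} := by
      intro b hb
      have h0 : Ideal.Quotient.mk (Ideal.span {ft}) ϖb * Ideal.Quotient.mk (Ideal.span {ft}) b = 0 := by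
        rw [← map_mul, Ideal.Quotient.eq_zero_iff_mem]; exact hb
      rcases mul_eq_zero.mp h0 with h | h
      · exact absurd (Ideal.Quotient.eq_zero_iff_mem.mp h) hϖft
      · exact Ideal.Quotient.eq_zero_iff_mem.mp h
    have hft0 : ft ≠ 0 := fun h => hft2 (by rw [h]; exact zero_mem _)
    haveI : IsDomain A := isDomain_of_isRegularLocalRing A
    rw [isSMulRegular_iff_right_eq_zero_of_smul]
    intro b hb
    rw [smul_eq_mul] at hb
    obtain ⟨a, rfl⟩ := hπWsurj b
    have hfa : ft * a ∈ Ideal.span {ϖb} := by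
      rw [← hkerW, RingHom.mem_ker, map_mul, hft]; exact hb
    have ha := mem_span_of_mul_mem_span_swap hft0 hϖreg a hfa
    rw [← hkerW] at ha
    exact ha

/-! ## §3 `EmbeddedLiftFact`'s local-complete-intersection clause for `i : V(𝓘) ⟶ V(𝓙)` -/

include hθ hsqW in
/-- ★★ **THE lci CLAUSE OF (F) FOR A ONE-PARAMETER CUT OF A (POSSIBLY NON-REDUCED) HOST TRACE** (D13 supplier part 1): `G` locally Noetherian and
quasi-compact, `V(𝓙)` the special fibre of a REGULAR locally Noetherian `O`-flat model `W` (model square `jW`), `i : V(𝓘) ⟶ V(𝓙)` over `G`, (Γ1)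
`dim 𝒪_{V(𝓘),z} = 1` and (Γ2) `dim 𝒪_{V(𝓙),i z} = 2` at closed `z`, and the letter (PΓ) at every closed point of `supp 𝓘` — then every point of `V(𝓘)`
has an affine open neighbourhood `U` in `V(𝓙)` on which the ideal of `V(𝓘)` is generated by ONE NON-ZERO-DIVISOR, i.e. by the weakly regular sequence
`[j]`: `EmbeddedLiftFact`'s clause VERBATIM in shape.  ✓ `SecCurve.exists_affineOpens_isWeaklyRegular_ker`'s proof by substitution.
[folklore; every characteristic] [OURS · D13 supplier part 1; counted 0] -/
theorem exists_affineOpens_isWeaklyRegular_ker [IsLocallyNoetherian G] [CompactSpace G] [IsLocallyNoetherian W] [Flat w]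
    (hWreg : Scheme.IsRegular W) (i : 𝓘.subscheme ⟶ 𝓙.subscheme) (hi : i ≫ 𝓙.subschemeι = 𝓘.subschemeι)
    (hEdim : ∀ z : ↥(𝓘.subscheme), IsClosed ({z} : Set ↥(𝓘.subscheme)) →
      ringKrullDim ((𝓙.subscheme).presheaf.stalk (i z)) = ((2 : ℕ) : WithBot ℕ∞))
    (hZdim : ∀ z : ↥(𝓘.subscheme), IsClosed ({z} : Set ↥(𝓘.subscheme)) →
      ringKrullDim ((𝓘.subscheme).presheaf.stalk z) = ((1 : ℕ) : WithBot ℕ∞))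
    (hL2 : ∀ z ∈ (𝓘.support : Set G), IsClosed ({z} : Set G) → ∃ f : G.presheaf.stalk z,
      stalkIdeal (𝓘) z = stalkIdeal (𝓙) z ⊔ Ideal.span {f} ∧
        f ∉ stalkIdeal (𝓙) z ⊔ maximalIdeal (G.presheaf.stalk z) ^ 2) :
    ∀ z : ↥(𝓘.subscheme), ∃ U : (𝓙.subscheme).affineOpens, i.base z ∈ (U : (𝓙.subscheme).Opens) ∧
      ∃ rs : List Γ(𝓙.subscheme, U), RingTheory.Sequence.IsWeaklyRegular Γ(𝓙.subscheme, U) rs ∧ Ideal.ofList rs = i.ker.ideal U := by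
  -- adapted from ✓ p696215 `NodalCurve.exists_affineOpens_isWeaklyRegular_ker` (res-L1-w45b-nose-w1 g5)
  classical
  haveI : IsClosedImmersion (i ≫ 𝓙.subschemeι) := by rw [hi]; infer_instance
  haveI : IsClosedImmersion i := IsClosedImmersion.of_comp_isClosedImmersion i (𝓙.subschemeι)
  haveI : IsLocallyNoetherian (𝓙.subscheme) := LocallyOfFiniteType.isLocallyNoetherian (𝓙.subschemeι)
  -- closed points suffice
  haveI : CompactSpace ↥(𝓘.subscheme) := QuasiCompact.compactSpace_of_compactSpace (𝓘.subschemeι)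
  suffices hcl : ∀ z₀ : ↥(𝓘.subscheme), IsClosed ({z₀} : Set ↥(𝓘.subscheme)) →
      ∃ U : (𝓙.subscheme).affineOpens, i.base z₀ ∈ (U : (𝓙.subscheme).Opens) ∧
        ∃ rs : List Γ(𝓙.subscheme, U), RingTheory.Sequence.IsWeaklyRegular Γ(𝓙.subscheme, U) rs ∧ Ideal.ofList rs = i.ker.ideal U by
    intro z
    obtain ⟨z₀, hz₀, hcl₀⟩ := (isClosed_closure (s := ({z} : Set ↥(𝓘.subscheme)))).exists_closed_singleton ⟨z, subset_closure rfl⟩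
    have hzz₀ : z ⤳ z₀ := specializes_iff_mem_closure.mpr hz₀
    obtain ⟨U, hU, rs, hrs⟩ := hcl z₀ hcl₀
    exact ⟨U, (hzz₀.map i.continuous).mem_open U.1.isOpen hU, rs, hrs⟩
  intro z₀ hz₀
  -- ★ at the closed point: generator `f ∈ 𝔪 ∖ 𝔪²`, a non-zero-divisor
  have hzZ : ((𝓘.subschemeι) z₀ : G) ∈ (𝓘.support : Set G) := by
    rw [← Scheme.IdealSheafData.range_subschemeι]; exact ⟨z₀, rfl⟩
  have hzc : IsClosed ({(𝓘.subschemeι) z₀} : Set G) := by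
    simpa only [Set.image_singleton] using (𝓘.subschemeι).isClosedEmbedding.isClosedMap _ hz₀
  obtain ⟨f, hf, -, hf2, hfreg⟩ := ker_stalkMap_eq_span_and_isSMulRegular O θ hθ 𝓘 𝓙 w jW tW hsqW hWreg i hi z₀ (hZdim z₀ hz₀)
    (hEdim z₀ hz₀) (hL2 _ hzZ hzc)
  have hf0 : f ≠ 0 := fun h => hf2 (h ▸ zero_mem _)
  have hf' : stalkIdeal i.ker (i z₀) = Ideal.span {f} := (stalkIdeal_ker_eq_ker_stalkMap i z₀).trans hf
  -- an affine open neighbourhood `U₀`, its (Noetherian) ring `R`, the prime `𝔮` of `i z₀`, and the stalk as `R_𝔮`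
  obtain ⟨U₀, hU₀, hxU₀, -⟩ := exists_isAffineOpen_mem_and_subset (X := 𝓙.subscheme) (x := i z₀) (U := ⊤) (Opens.mem_top _)
  letI := TopCat.Presheaf.algebra_section_stalk (𝓙.subscheme).presheaf (⟨i z₀, hxU₀⟩ : (U₀ : (𝓙.subscheme).Opens))
  haveI := hU₀.isLocalization_stalk ⟨i z₀, hxU₀⟩
  set 𝔮 := (hU₀.primeIdealOf ⟨i z₀, hxU₀⟩).asIdeal with h𝔮
  set J : Ideal Γ(𝓙.subscheme, U₀) := i.ker.ideal ⟨U₀, hU₀⟩ with hJ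
  -- the stalk ideal is `J · R_𝔮 = (f)`; pick `j ∈ J` whose germ generates it — it is then a non-zero-divisor too
  have hJf : J.map (algebraMap Γ(𝓙.subscheme, U₀) ((𝓙.subscheme).presheaf.stalk (i z₀))) = Ideal.span {f} := by
    rw [← hf', stalkIdeal_eq_map_germ i.ker ⟨U₀, hU₀⟩ hxU₀]; rfl
  obtain ⟨s, ⟨j, hjJ, rfl⟩, hsj⟩ := NodalCurve.exists_mem_span_singleton_eq
    (S := ⇑(algebraMap Γ(𝓙.subscheme, U₀) ((𝓙.subscheme).presheaf.stalk (i z₀))) '' (J : Set Γ(𝓙.subscheme, U₀))) hf0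
    (by rw [← hJf]; rfl)
  have hjJ' : j ∈ J := hjJ
  have hjreg : IsSMulRegular ((𝓙.subscheme).presheaf.stalk (i z₀)) (algebraMap Γ(𝓙.subscheme, U₀) ((𝓙.subscheme).presheaf.stalk (i z₀)) j) :=
    isSMulRegular_of_span_singleton_eq hfreg hsj
  -- spread the generator: `g₁ ∉ 𝔮` with `g₁ x ∈ jR` for `x ∈ J`
  have hJle : J.map (algebraMap Γ(𝓙.subscheme, U₀) ((𝓙.subscheme).presheaf.stalk (i z₀))) ≤
      Ideal.span {algebraMap Γ(𝓙.subscheme, U₀) ((𝓙.subscheme).presheaf.stalk (i z₀)) j} := by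
    rw [hJf, ← hsj]
  haveI : IsNoetherianRing Γ(𝓙.subscheme, U₀) := IsLocallyNoetherian.component_noetherian ⟨U₀, hU₀⟩
  obtain ⟨g₁, hg₁, H₁⟩ := Literature.RingTheory.UniqueFactorizationDomain.exists_notMem_forall_mul_mem_of_fg (q := 𝔮)
    (IsNoetherian.noetherian J) (Literature.RingTheory.UniqueFactorizationDomain.exists_mul_eq_of_map_le_span hJle)
  -- spread the non-zero-divisor: `g₂ ∉ 𝔮` killing the annihilator of `j`
  obtain ⟨g₂, hg₂, H₂⟩ := exists_notMem_forall_mul_eq_zero_of_isSMulRegular 𝔮 (A := (𝓙.subscheme).presheaf.stalk (i z₀)) hjreg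
  -- the basic open `D(g₁ g₂) ∋ i z₀`
  have hgq : g₁ * g₂ ∉ 𝔮 := fun h => ((inferInstance : 𝔮.IsPrime).mem_or_mem h).elim hg₁ hg₂
  have hxg : (i z₀ : ↥(𝓙.subscheme)) ∈ (𝓙.subscheme).basicOpen (g₁ * g₂) := by
    rw [(𝓙.subscheme).mem_basicOpen (g₁ * g₂) (i z₀) hxU₀]
    exact (IsLocalization.AtPrime.isUnit_to_map_iff ((𝓙.subscheme).presheaf.stalk (i z₀)) 𝔮 (g₁ * g₂)).mpr hgq
  haveI := hU₀.isLocalization_basicOpen (g₁ * g₂)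
  refine ⟨(𝓙.subscheme).affineBasicOpen (U := ⟨U₀, hU₀⟩) (g₁ * g₂), hxg,
    [algebraMap Γ(𝓙.subscheme, U₀) Γ(𝓙.subscheme, (𝓙.subscheme).basicOpen (g₁ * g₂)) j], ?_, ?_⟩
  · -- `[j]` is weakly regular on `Γ(D(g₁ g₂))`: `j` is a non-zero-divisor there
    show RingTheory.Sequence.IsWeaklyRegular Γ(𝓙.subscheme, (𝓙.subscheme).basicOpen (g₁ * g₂))
      [algebraMap Γ(𝓙.subscheme, U₀) Γ(𝓙.subscheme, (𝓙.subscheme).basicOpen (g₁ * g₂)) j]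
    rw [RingTheory.Sequence.isWeaklyRegular_singleton_iff]
    exact NodalCurve.isSMulRegular_algebraMap_of_away (g := g₁ * g₂) (fun a ha => by rw [mul_assoc, H₂ a ha, mul_zero])
  · -- `(ker i)(D(g₁ g₂)) = J · Γ(D(g₁ g₂)) = (j)`
    have hunit : IsUnit (algebraMap Γ(𝓙.subscheme, U₀) Γ(𝓙.subscheme, (𝓙.subscheme).basicOpen (g₁ * g₂)) (g₁ * g₂)) :=
      IsLocalization.Away.algebraMap_isUnit (g₁ * g₂)
    have hmap := NodalCurve.map_eq_span_singleton_of_forall_mul_eq hjJ' (fun x hx => by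
      obtain ⟨a, ha⟩ := H₁ x hx
      exact ⟨g₂ * a, by rw [mul_assoc, mul_comm g₂ x, ← mul_assoc, ha]; ring⟩) hunit
    have h3 := i.ker.map_ideal_basicOpen ⟨U₀, hU₀⟩ (g₁ * g₂)
    show Ideal.ofList [algebraMap Γ(𝓙.subscheme, U₀) Γ(𝓙.subscheme, (𝓙.subscheme).basicOpen (g₁ * g₂)) j] =
      i.ker.ideal ((𝓙.subscheme).affineBasicOpen (U := ⟨U₀, hU₀⟩) (g₁ * g₂))
    rw [Ideal.ofList_singleton]
    exact hmap.symm.trans h3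

end Stalk
end Summit.ResolutionOfSingularities.ResolutionOfSingularities.Cruxes.EquisingularLiftNat.Sections.ERound

end
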